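import Literature.Barriers.ValiantsHypothesis.BDGIL24EnvelopingAlgebraAction
import Literature.NumberTheory.Automorphic.HarishChandraCore
import HarnessLib

/-!
# Central characters on the isotypic components of the metapolynomial representation
# ([BDGIL24, §4.4]) — PROVED, via the tree's Harish-Chandra core for `gl_k`; Cor. 5.5 with its
# length bound in `U(gl_k)` (`cor_5_5_length`)

[BDGIL24] = M. van den Berg, P. Dutta, F. Gesmundo, C. Ikenmeyer, V. Lysikov, *Algebraic
metacomplexity and representation theory*, arXiv:2411.03444, §4.4 (p.20, PDF p.21; held text
paper:arxiv-2411.03444 p0021.txt:L1–L27):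

> "An element `X ∈ U(𝔤)` of the universal enveloping algebra is central if `XY = YX` for every
> `Y ∈ U(𝔤)` […]. A representation `ρ : 𝔤 → End(V)` of `𝔤` extends to a representation of `U(𝔤)`,
> and if `X ∈ Z(𝔤)` is a central element, the map `ρ(X) : V → V` is `U(𝔤)`-equivariant. If `V` is
> irreducible, then by Schur's lemma `ρ(X)` is a multiplication by some scalar `χ_V(X)`. […] This
> representation is called the central character of `V`. […] as a `Z(𝔤)`-representation we have
> `V ≅ ⨁_{λ ∈ Λ} χ_λ^{⊕ m_λ · dim V_λ}`, where we denote by `χ_λ` the 1-dimensional representation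
> of `Z(𝔤)` corresponding to the central character of `V_λ`."

## What is typed and proved

For `gl_k` acting on metapolynomials of format `(δ, d, k)` (Claim 4.2, `lieOp`), in the block
matrix model `HCCore.𝔤 T k = T → Matrix (Fin k) (Fin k) ℂ` of the tree's Harish-Chandra core
(`Literature/NumberTheory/Automorphic/HarishChandraCore.lean`, namespace `HCCore`), `gl_k` acting
through a chosen block `τ₀ : T` (any finite index type `T`; `T = Unit` is the plain one-block model,
`T = (ℝ →ₐ[ℝ] ℂ)` — one embedding — is the index type at which the tree's Harish-Chandra
ISOMORPHISM `HarishChandraHomGL.complexified_injective_and_range_eq` is available):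

* the block bridge (plumbing, NOT a second notion): `HarishChandraCore` presents `gl_k^T` as the
  block matrix Lie algebra `HCCore.𝔤 T k = T → Matrix (Fin k) (Fin k) ℂ`; `evalBlock k τ₀`
  (`X ↦ X τ₀`, a Lie algebra morphism onto `gl_k`), `lieOpHomGL k d τ₀ := (lieOpHom k d).comp
  (evalBlock k τ₀)` (the tree's Claim-4.2 morphism `lieOpHom` of `BDGIL24EnvelopingAlgebraAction`,
  precomposed) and `envActGL k d τ₀` its extension to `U(T → gl_k)`; `envActGL_eq_envAct_comp` ties
  it to the tree's `U(gl_k)`-action `envAct` along the induced algebra map `envEvalBlock`;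
* `isHighestWeightVectorC_of_mem_highestWeightSpace` — a nonzero highest weight metapolynomial of
  weight `χ` (group level, `highestWeightSpace (coordRep)`) is a highest weight vector of weight `χ`
  for `gl_k` in the sense of `HighestWeightGL.IsHighestWeightVectorC` (via the group ↔ Lie
  dictionary `mem_highestWeightSpace_coordRep_iff`);
* **`envActGL_center_apply_of_mem_highestWeightSpace`** — every `z ∈ Z(gl_k)` acts on a highest
  weight metapolynomial of weight `λ` by the scalar `χ_λ(z) = (hcProj z)(λ)` (the central character,
  in the Harish-Chandra-projection form of `HCCore.lift_center_hw`; the weight of `gl_k^T` is `λ` on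
  the block `τ₀` and `0` elsewhere, `blockWt τ₀ λ`);
* **`envActGL_center_apply_of_mem_hwSubrep`** — **`Z(gl_k)` acts on the `λ`-isotypic component of
  `ℂ[ℂ[x₁,…,x_k]_d]_δ` by the central character `χ_λ`**: for `Δ` homogeneous of degree `δ` in
  `hwSubrep (coordRep) λ` and `z` central, `z.Δ = χ_λ(z) Δ` (the displayed `Z(𝔤)`-decomposition,
  block by block). Ingredients: `ρ(g)` restricted to a degree lies in the image of `U(gl_k)`
  (`exists_adjoin_lieOp_eq_coordRep`), with which central elements commute
  (`envActGL_center_comm_of_mem_adjoin`), and the isotypic component of the degree-`δ` part is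
  spanned by translates of its own highest weight vectors (`exists_isotypic_decomposition`).

* **`cor_5_5_length`** — [BDGIL24, Cor. 5.5] WITH ITS LENGTH BOUND, literally in `U(gl_k)`: an
  `H` of PBW-filtration level `≤ (δd+1)^k` ("length", §4.3: `U(𝔤)_{≤ℓ}` = the tree's
  `Literature.Algebra.Lie.PBW.fil` for the standard basis `HCCore.stdB T k`) acting on degree-`δ`
  metapolynomials as the weight projector (the ordered product of the affine Cartan factors of the
  tree's `cor_5_5`; printed count `(δd)^k`, typed `(δd+1)^k` as in `cor_5_5`).

* (appended) the isotypic components and highest weight spaces of `coordRep` are GRADED by the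
  degree `δ` (`homogeneousComponent_mem_hwSubrep`, `homogeneousComponent_mem_highestWeightSpace`,
  `homogeneousComponent_coordRep`), hence `envActGL_center_apply_of_mem_hwSubrep'`: `Z(gl_k)` acts by
  `χ_λ` on the `λ`-isotypic component of the WHOLE space `ℂ[ℂ[x₁,…,x_k]_d]`.

Not typed here: Thm. 4.11 (central characters SEPARATE non-isomorphic irreducibles — for `gl_k`
this follows from `HCCore.injective_and_range_eq_of_hasHWProperty` given a Harish-Chandra
homomorphism with symmetric values; the tree has one at `T = (ℝ →ₐ[ℝ] ℂ)`,
`HarishChandraHomGL.complexified_injective_and_range_eq` with `nonempty_harishChandraHomGL_holds`,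
which is why every statement below is made for an arbitrary block `τ₀ : T`), Thm. 4.13, the Perelomov–Popov eigenvalues (9), and hence the
LENGTH bounds of Cor. 5.6–5.8. The Casimir elements (8) `C_p = tr(𝔼^p)` are the tree's
`HCCore.casimir` (central: `HCCore.casimir_mem_center`; length `≤ p`: `HCCore.casimir_mem_fil`).

Honest framing: representation-theoretic bookkeeping; nothing here bears on `VP ≠ VNP`.

## References
* [BergEtAl2024] arXiv:2411.03444, §4.3 (length, p.19), §4.4 (p.20–21, PDF pp.21–22), Cor. 5.5 (p.27).
* [Humphreys1972] J. E. Humphreys, *Introduction to Lie Algebras and Representation Theory*,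
  GTM 9, §23.2–23.3 (`χ_λ(z) = λ(ξ(z))`), as vendored in `HarishChandraCore`.
-/

noncomputable section

-- Mathlib idiom: the commutator bracket on an associative algebra (`T → Matrix (Fin k) (Fin k) ℂ`),
-- as in `Mathlib.Algebra.Lie.UniversalEnveloping` and the tree's `HighestWeightGL` / `HarishChandraCore`
attribute [local instance 100] LieRing.ofAssociativeRing

open MvPolynomial UniversalEnvelopingAlgebra
open scoped BigOperators

namespace Literature.Barriers.ValiantsHypothesis

namespace BergEtAl2024

open Literature.Computability.AlgebraicComplexity Literature.NumberTheory.DiophantineGeometry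
open Literature.NumberTheory.Automorphic (IsHighestWeightVectorC)

variable {k d : ℕ} {T : Type*} [Fintype T] [DecidableEq T]

/-! ### The block matrix model of `HarishChandraCore` (plumbing) -/

omit [Fintype T] [DecidableEq T] in
/-- Evaluation at the block `τ₀`: the Lie algebra morphism `(T → gl_k) → gl_k`, `X ↦ X τ₀`
(commutator brackets on both sides). The block domain exists only to match `HCCore.𝔤 T k`
(`HarishChandraCore`), where the Harish-Chandra projection `hcProj`, the centre and the Casimir
elements live; it is not a second notion of `gl_k`. [folklore] -/
def evalBlock (k : ℕ) (τ₀ : T) : (T → Matrix (Fin k) (Fin k) ℂ) →ₗ⁅ℂ⁆ Matrix (Fin k) (Fin k) ℂ :=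
  { toFun := fun X => X τ₀
    map_add' := fun _ _ => rfl
    map_smul' := fun _ _ => rfl
    map_lie' := fun {_ _} => rfl }

omit [Fintype T] [DecidableEq T] in
/-- `evalBlock τ₀ X = X τ₀`. [cite: BergEtAl2024, §4.3, p.19 (PDF p.20)] -/
@[simp] theorem evalBlock_apply (τ₀ : T) (X : T → Matrix (Fin k) (Fin k) ℂ) :
    evalBlock k τ₀ X = X τ₀ := rfl

variable (τ₀ : T)

omit [Fintype T] [DecidableEq T] in
/-- **Claim 4.2 in the block model**: the tree's Lie algebra morphism `lieOpHom k d`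
(`BDGIL24EnvelopingAlgebraAction`) precomposed with `evalBlock τ₀`, i.e. `X ↦ lieOp (X τ₀)` —
`gl_k^T` acting on metapolynomials through its block `τ₀`.
[cite: BergEtAl2024, §4, Claim 4.2, p.12–13 (PDF pp.13–14)] locator: paper:arxiv-2411.03444 p0013.txt:L55–L58, p0014.txt:L1–L13 -/
def lieOpHomGL (k d : ℕ) (τ₀ : T) :
    (T → Matrix (Fin k) (Fin k) ℂ) →ₗ⁅ℂ⁆ Module.End ℂ (MvPolynomial (DegIdx (Fin k) d) ℂ) :=
  (lieOpHom k d).comp (evalBlock k τ₀)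

omit [Fintype T] [DecidableEq T] in
/-- `lieOpHomGL τ₀ X = lieOpHom (X τ₀) = lieOp (X τ₀)`. [cite: BergEtAl2024, §4, Claim 4.2, p.12–13 (PDF pp.13–14)] -/
@[simp] theorem lieOpHomGL_apply (X : T → Matrix (Fin k) (Fin k) ℂ) :
    lieOpHomGL k d τ₀ X = (lieOp k d (X τ₀) : Module.End ℂ (MvPolynomial (DegIdx (Fin k) d) ℂ)) := rfl

omit [Fintype T] [DecidableEq T] in
/-- `lieOpHomGL τ₀ X = lieOpHom (X τ₀)` (same morphism, through the block `τ₀`). [cite: BergEtAl2024, §4, Claim 4.2, p.12–13 (PDF pp.13–14)] -/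
theorem lieOpHomGL_eq_lieOpHom (X : T → Matrix (Fin k) (Fin k) ℂ) :
    lieOpHomGL k d τ₀ X = lieOpHom k d (X τ₀) := rfl

omit [Fintype T] [DecidableEq T] in
/-- **The action of `U(T → gl_k)` on metapolynomials** through the block `τ₀`, extending
`lieOpHomGL τ₀`; equal to the tree's `envAct` along `envEvalBlock τ₀` (`envActGL_eq_envAct_comp`).
[cite: BergEtAl2024, §4.3, p.19 (PDF p.20)] locator: paper:arxiv-2411.03444 p0020.txt:L12–L16 -/
def envActGL (k d : ℕ) (τ₀ : T) :
    UniversalEnvelopingAlgebra ℂ (T → Matrix (Fin k) (Fin k) ℂ) →ₐ[ℂ]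
      Module.End ℂ (MvPolynomial (DegIdx (Fin k) d) ℂ) :=
  UniversalEnvelopingAlgebra.lift ℂ (lieOpHomGL k d τ₀)

omit [Fintype T] [DecidableEq T] in
/-- On generators: `envActGL τ₀ (ι X) = lieOp (X τ₀)`. [cite: BergEtAl2024, §4.3, p.19 (PDF p.20)] -/
@[simp] theorem envActGL_ι (X : T → Matrix (Fin k) (Fin k) ℂ) :
    envActGL k d τ₀ (UniversalEnvelopingAlgebra.ι ℂ X) =
      (lieOp k d (X τ₀) : Module.End ℂ (MvPolynomial (DegIdx (Fin k) d) ℂ)) :=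
  UniversalEnvelopingAlgebra.lift_ι_apply ℂ (lieOpHomGL k d τ₀) X

omit [Fintype T] in
/-- Every `lieOp N` is in the image of `U(T → gl_k)`: `lieOp N = envActGL τ₀ (ι (Pi.single τ₀ N))`.
[cite: BergEtAl2024, §4.3, p.19 (PDF p.20)] -/
theorem lieOp_eq_envActGL_ι (N : Matrix (Fin k) (Fin k) ℂ) :
    (lieOp k d N : Module.End ℂ (MvPolynomial (DegIdx (Fin k) d) ℂ)) =
      envActGL k d τ₀ (UniversalEnvelopingAlgebra.ι ℂ (Pi.single τ₀ N : T → Matrix (Fin k) (Fin k) ℂ)) := by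
  rw [envActGL_ι, Pi.single_eq_same]

omit [Fintype T] [DecidableEq T] in
/-- The algebra morphism `U(T → gl_k) → U(gl_k)` induced by `evalBlock τ₀` (functoriality of the
universal enveloping algebra). [folklore] -/
def envEvalBlock (k : ℕ) (τ₀ : T) :
    UniversalEnvelopingAlgebra ℂ (T → Matrix (Fin k) (Fin k) ℂ) →ₐ[ℂ]
      UniversalEnvelopingAlgebra ℂ (Matrix (Fin k) (Fin k) ℂ) :=
  UniversalEnvelopingAlgebra.lift ℂ ((UniversalEnvelopingAlgebra.ι ℂ).comp (evalBlock k τ₀))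

omit [Fintype T] [DecidableEq T] in
/-- On generators: `envEvalBlock τ₀ (ι X) = ι (X τ₀)` (universal property of `U(𝔤)`).
[cite: BergEtAl2024, §4.3, p.19 (PDF p.20)] locator: paper:arxiv-2411.03444 p0020.txt:L12–L16 -/
@[simp] theorem envEvalBlock_ι (X : T → Matrix (Fin k) (Fin k) ℂ) :
    envEvalBlock k τ₀ (UniversalEnvelopingAlgebra.ι ℂ X) = UniversalEnvelopingAlgebra.ι ℂ (X τ₀) :=
  UniversalEnvelopingAlgebra.lift_ι_apply ℂ _ X

omit [Fintype T] [DecidableEq T] in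
/-- **Bridge to the tree's `U(gl_k)`-action**: `envActGL τ₀ = envAct ∘ envEvalBlock τ₀` (both are
the unique extension of `X ↦ lieOp (X τ₀)`). [cite: BergEtAl2024, §4.3, p.19 (PDF p.20)] locator: paper:arxiv-2411.03444 p0020.txt:L12–L16 -/
theorem envActGL_eq_envAct_comp : envActGL k d τ₀ = (envAct k d).comp (envEvalBlock k τ₀) := by
  apply UniversalEnvelopingAlgebra.hom_ext
  refine LieHom.ext fun X => ?_
  change envActGL k d τ₀ (UniversalEnvelopingAlgebra.ι ℂ X) =
    envAct k d (envEvalBlock k τ₀ (UniversalEnvelopingAlgebra.ι ℂ X))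
  rw [envActGL_ι, envEvalBlock_ι, envAct_ι]

omit [Fintype T] [DecidableEq T] in
/-- Pointwise form of the bridge. [cite: BergEtAl2024, §4.3, p.19 (PDF p.20)] -/
theorem envActGL_apply (u : UniversalEnvelopingAlgebra ℂ (T → Matrix (Fin k) (Fin k) ℂ)) :
    envActGL k d τ₀ u = envAct k d (envEvalBlock k τ₀ u) := by
  rw [envActGL_eq_envAct_comp, AlgHom.comp_apply]

omit [Fintype T] [DecidableEq T] in
/-- Hence every `envActGL τ₀ u` lies in the `lieOp`-algebra (the image of `U(gl_k)`, `range_envAct`).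
[cite: BergEtAl2024, §4.3, p.18–19 (PDF pp.19–20)] -/
theorem envActGL_mem_adjoin_lieOp (u : UniversalEnvelopingAlgebra ℂ (T → Matrix (Fin k) (Fin k) ℂ)) :
    envActGL k d τ₀ u ∈ Algebra.adjoin ℂ (Set.range fun N : Matrix (Fin k) (Fin k) ℂ =>
      (lieOp k d N : Module.End ℂ (MvPolynomial (DegIdx (Fin k) d) ℂ))) := by
  rw [envActGL_apply]
  exact envAct_mem_adjoin_lieOp _

omit [Fintype T] in
/-- **A central element of `U(gl_k)` commutes with the whole `lieOp`-algebra** (the image of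
`U(gl_k)`; "if `X ∈ Z(𝔤)` is a central element, the map `ρ(X)` is `U(𝔤)`-equivariant"). Proved by
a direct induction over the generators `lieOp N = envActGL (ι (fun _ ↦ N))` (centrality of `z` is a
statement inside `U(T → gl_k)`; going through `range_envAct` would need more plumbing on
`envEvalBlock`, which is not otherwise used).
[cite: BergEtAl2024, §4.4, p.20 (PDF p.21)] locator: paper:arxiv-2411.03444 p0021.txt:L5–L6 -/
theorem envActGL_center_comm_of_mem_adjoin
    {z : UniversalEnvelopingAlgebra ℂ (T → Matrix (Fin k) (Fin k) ℂ)}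
    (hz : z ∈ Subalgebra.center ℂ (UniversalEnvelopingAlgebra ℂ (T → Matrix (Fin k) (Fin k) ℂ)))
    {P : Module.End ℂ (MvPolynomial (DegIdx (Fin k) d) ℂ)}
    (hP : P ∈ Algebra.adjoin ℂ (Set.range fun N : Matrix (Fin k) (Fin k) ℂ =>
      (lieOp k d N : Module.End ℂ (MvPolynomial (DegIdx (Fin k) d) ℂ)))) :
    P * envActGL k d τ₀ z = envActGL k d τ₀ z * P := by
  induction hP using Algebra.adjoin_induction with
  | mem P hP =>
    obtain ⟨N, rfl⟩ := hP
    change ((lieOp k d N : _) : Module.End ℂ (MvPolynomial (DegIdx (Fin k) d) ℂ)) * envActGL k d τ₀ z =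
      envActGL k d τ₀ z * ((lieOp k d N : _) : Module.End ℂ (MvPolynomial (DegIdx (Fin k) d) ℂ))
    rw [lieOp_eq_envActGL_ι τ₀, ← map_mul, ← map_mul, Subalgebra.mem_center_iff.1 hz]
  | algebraMap r => rw [Algebra.commutes]
  | add P Q _ _ hP hQ => rw [add_mul, mul_add, hP, hQ]
  | mul P Q _ _ hP hQ => rw [mul_assoc, hQ, ← mul_assoc, hP, mul_assoc]

/-! ### Highest weight metapolynomials are highest weight vectors for `gl_k` -/

/-- `lieOp` of a finite sum (plumbing). [cite: BergEtAl2024, §4, Claim 4.2, p.12–13 (PDF pp.13–14)] -/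
theorem lieOp_finset_sum {ι : Type*} (s : Finset ι) (N : ι → Matrix (Fin k) (Fin k) ℂ) :
    lieOp k d (∑ i ∈ s, N i) = ∑ i ∈ s, lieOp k d (N i) := by
  classical
  induction s using Finset.induction_on with
  | empty => rw [Finset.sum_empty, Finset.sum_empty, lieOp_zero]
  | insert a s ha ih => rw [Finset.sum_insert ha, Finset.sum_insert ha, lieOp_add, ih]

/-- Applying a finite sum of derivations (plumbing). [folklore] -/
private theorem derivation_sum_apply' {ι A : Type*} [CommRing A] [Algebra ℂ A] (s : Finset ι)
    (D : ι → Derivation ℂ A A) (a : A) : (∑ i ∈ s, D i) a = ∑ i ∈ s, D i a := by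
  classical
  induction s using Finset.induction_on with
  | empty => simp
  | insert b s hb ih => rw [Finset.sum_insert hb, Finset.sum_insert hb, Derivation.add_apply, ih]

omit [Fintype T] in
/-- The weight of `gl_k^T` attached to a weight `χ` of `gl_k` placed in the block `τ₀` (zero in the
other blocks) — the highest weight of a highest weight metapolynomial for `lieOpHomGL τ₀`
(plumbing). [folklore] -/
def blockWt (τ₀ : T) (χ : Weight (Fin k)) : T → Fin k → ℂ :=
  fun τ i => if τ = τ₀ then ((χ i : ℤ) : ℂ) else 0

omit [Fintype T] in
/-- `blockWt τ₀ χ τ₀ i = χ i`. [cite: BergEtAl2024, §4.2, p.17 (PDF p.18)] -/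
@[simp] theorem blockWt_self (χ : Weight (Fin k)) (i : Fin k) :
    blockWt τ₀ χ τ₀ i = ((χ i : ℤ) : ℂ) := if_pos rfl

omit [Fintype T] in
/-- `blockWt τ₀ χ τ i = 0` off the block `τ₀`. [cite: BergEtAl2024, §4.2, p.17 (PDF p.18)] -/
theorem blockWt_of_ne (χ : Weight (Fin k)) {τ : T} (hτ : τ ≠ τ₀) (i : Fin k) :
    blockWt τ₀ χ τ i = 0 := if_neg hτ

/-- **A nonzero highest weight metapolynomial of weight `χ` is a highest weight vector (of weight
`χ` in the block `τ₀`, `blockWt τ₀ χ`) for the Lie algebra `gl_k^T` acting through `τ₀`** (strictly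
upper triangular matrices kill it, the diagonal matrix `diag(h)` multiplies it by `Σ_i χ_i h_{τ₀,i}`):
the tree's group-level notion `highestWeightSpace (coordRep)` meets
`HighestWeightGL.IsHighestWeightVectorC` through the dictionary `mem_highestWeightSpace_coordRep_iff`
([BDGIL24, §4.2, p.17]: "a weight vector `v` is called a highest weight vector if `𝔫.v = 0` …
equivalent to the characterization of highest weight metapolynomials in Section 1").
[cite: BergEtAl2024, §4.2, p.17 (PDF p.18)] locator: paper:arxiv-2411.03444 p0018.txt:L37–L40 -/
theorem isHighestWeightVectorC_of_mem_highestWeightSpace {χ : Weight (Fin k)}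
    {F : MvPolynomial (DegIdx (Fin k) d) ℂ} (hF : F ∈ highestWeightSpace (coordRep (Fin k) ℂ d) χ)
    (hF0 : F ≠ 0) :
    IsHighestWeightVectorC (lieOpHomGL k d τ₀) (blockWt τ₀ χ) F := by
  classical
  obtain ⟨hFw, hFn⟩ := (mem_highestWeightSpace_coordRep_iff χ F).1 hF
  refine ⟨hF0, fun X hX => ?_, fun h => ?_⟩
  · -- strictly upper triangular matrices are combinations of the raising operators `E_{ij}`, `i < j`
    rw [lieOpHomGL_apply]
    change lieOp k d (X τ₀) F = 0
    rw [Matrix.matrix_eq_sum_single (X τ₀), lieOp_finset_sum, derivation_sum_apply']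
    refine Finset.sum_eq_zero fun i _ => ?_
    rw [lieOp_finset_sum, derivation_sum_apply']
    refine Finset.sum_eq_zero fun j _ => ?_
    by_cases hij : i < j
    · have hs : Matrix.single i j (X τ₀ i j) = X τ₀ i j • Matrix.single i j (1 : ℂ) := by
        rw [Matrix.smul_single, smul_eq_mul, mul_one]
      rw [hs, lieOp_smul, Derivation.smul_apply, hFn i j hij, smul_zero]
    · rw [hX τ₀ i j (not_lt.1 hij), Matrix.single_zero, lieOp_zero, Derivation.zero_apply]
  · -- the diagonal torus acts by the weight
    rw [lieOpHomGL_apply]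
    change lieOp k d (Matrix.diagonal (h τ₀)) F = _
    have hsum : (∑ τ : T, ∑ i : Fin k, blockWt τ₀ χ τ i * h τ i) =
        ∑ i : Fin k, ((χ i : ℤ) : ℂ) * h τ₀ i := by
      rw [Finset.sum_eq_single τ₀]
      · simp_rw [blockWt_self]
      · intro τ _ hτ
        exact Finset.sum_eq_zero fun i _ => by rw [blockWt_of_ne τ₀ χ hτ, zero_mul]
      · exact fun hτ => absurd (Finset.mem_univ τ₀) hτ
    rw [lieOp_diagonal, derivation_sum_apply', hsum, Finset.sum_smul]
    refine Finset.sum_congr rfl fun i _ => ?_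
    rw [Derivation.smul_apply, eulerOp_apply_of_mem_weightSpace i hFw, smul_smul, mul_comm]

/-! ### The centre acts by the central character -/

/-- **`Z(gl_k)` acts on a highest weight metapolynomial of weight `λ` by the central character
`χ_λ(z) = (hcProj z)(λ)`** (Harish-Chandra projection form, `HCCore.lift_center_hw`).
[cite: BergEtAl2024, §4.4, p.20 (PDF p.21)] locator: paper:arxiv-2411.03444 p0021.txt:L5–L10
[cite: Humphreys1972, §23.2] -/
theorem envActGL_center_apply_of_mem_highestWeightSpace {χ : Weight (Fin k)}
    {F : MvPolynomial (DegIdx (Fin k) d) ℂ} (hF : F ∈ highestWeightSpace (coordRep (Fin k) ℂ d) χ)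
    {z : UniversalEnvelopingAlgebra ℂ (T → Matrix (Fin k) (Fin k) ℂ)}
    (hz : z ∈ Subalgebra.center ℂ (UniversalEnvelopingAlgebra ℂ (T → Matrix (Fin k) (Fin k) ℂ))) :
    envActGL k d τ₀ z F =
      MvPolynomial.eval (fun p : T × Fin k => blockWt τ₀ χ p.1 p.2)
        (Literature.NumberTheory.Automorphic.HCCore.hcProj T k z) • F := by
  by_cases hF0 : F = 0
  · rw [hF0, map_zero, smul_zero]
  · exact Literature.NumberTheory.Automorphic.HCCore.lift_center_hw
      (isHighestWeightVectorC_of_mem_highestWeightSpace τ₀ hF hF0) hz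

/-- A homogeneous element of the `χ`-isotypic component of the metapolynomial representation lies in
the span of the translates of the HOMOGENEOUS highest weight vectors of weight `χ` of its degree
(the isotypic component of the degree-`δ` subrepresentation is cut out by that of the whole space).
[cite: GoodmanWallachGTM255, §4.1.6 (isotypic decomposition)] -/
theorem mem_span_translates_homogeneous_of_mem_hwSubrep {δ : ℕ} {χ : Weight (Fin k)}
    {Δ : MvPolynomial (DegIdx (Fin k) d) ℂ} (hΔ : Δ.IsHomogeneous δ)
    (hΔχ : Δ ∈ hwSubrep (coordRep (Fin k) ℂ d) χ) :
    Δ ∈ Submodule.span ℂ {z | ∃ (g : GL (Fin k) ℂ) (v : MvPolynomial (DegIdx (Fin k) d) ℂ),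
        v ∈ homogeneousSubmodule (DegIdx (Fin k) d) ℂ δ ∧
          v ∈ highestWeightSpace (coordRep (Fin k) ℂ d) χ ∧ z = coordRep (Fin k) ℂ d g v} := by
  classical
  set M : Submodule ℂ (MvPolynomial (DegIdx (Fin k) d) ℂ) :=
    homogeneousSubmodule (DegIdx (Fin k) d) ℂ δ with hM
  haveI : FiniteDimensional ℂ M :=
    Module.Finite.iff_fg.mpr (homogeneousSubmodule_fg (DegIdx (Fin k) d) ℂ δ)
  have hMstab : ∀ g, M ≤ M.comap (coordRep (Fin k) ℂ d g) := fun g x hx =>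
    (mem_homogeneousSubmodule δ _).2 (isHomogeneous_coordSubst g ((mem_homogeneousSubmodule δ _).1 hx))
  obtain ⟨y, hy, hΔy⟩ := exists_isotypic_decomposition (isRationalRep_coordRep d) M hMstab
    ((mem_homogeneousSubmodule δ Δ).2 hΔ) χ
  have h₁ : y ∈ hwSubrep (coordRep (Fin k) ℂ d) χ := span_translates_highestWeight_le_hwSubrep M χ hy
  have h₁' : Δ - y ∈ ⨆ χ' ∈ {χ' : Weight (Fin k) | χ' ≠ χ}, hwSubrep (coordRep (Fin k) ℂ d) χ' :=
    iSup₂_mono (fun χ' _ => span_translates_highestWeight_le_hwSubrep M χ') hΔy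
  have hΔΔ : Δ - Δ ∈ ⨆ χ' ∈ {χ' : Weight (Fin k) | χ' ≠ χ}, hwSubrep (coordRep (Fin k) ℂ d) χ' := by
    rw [sub_self]
    exact Submodule.zero_mem _
  rw [← isotypicComponent_unique h₁ h₁' hΔχ hΔΔ]
  exact hy

/-- **[BDGIL24, §4.4] `Z(gl_k)` acts on the `λ`-isotypic component of `ℂ[ℂ[x₁,…,x_k]_d]_δ` by the
central character `χ_λ`**: for `Δ` homogeneous of degree `δ` in the `λ`-isotypic component
`hwSubrep (coordRep) λ` and `z ∈ Z(gl_k)`, `z.Δ = χ_λ(z) · Δ` with `χ_λ(z) = (hcProj z)(λ)` ("as a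
`Z(𝔤)`-representation we have `V ≅ ⨁_λ χ_λ^{⊕ m_λ dim V_λ}`"). Proof: the isotypic component of the
degree-`δ` part is spanned by translates `g.v` of homogeneous highest weight vectors
(`mem_span_translates_homogeneous_of_mem_hwSubrep`); `z` acts on `v` by `χ_λ(z)`
(`envActGL_center_apply_of_mem_highestWeightSpace`) and commutes with `ρ(g)`, which on degree `δ`
lies in the image of `U(gl_k)` (`exists_adjoin_lieOp_eq_coordRep`,
`envActGL_center_comm_of_mem_adjoin`).
[cite: BergEtAl2024, §4.4, p.20 (PDF p.21)] locator: paper:arxiv-2411.03444 p0021.txt:L18–L27 -/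
theorem envActGL_center_apply_of_mem_hwSubrep {δ : ℕ} {χ : Weight (Fin k)}
    {Δ : MvPolynomial (DegIdx (Fin k) d) ℂ} (hΔ : Δ.IsHomogeneous δ)
    (hΔχ : Δ ∈ hwSubrep (coordRep (Fin k) ℂ d) χ)
    {z : UniversalEnvelopingAlgebra ℂ (T → Matrix (Fin k) (Fin k) ℂ)}
    (hz : z ∈ Subalgebra.center ℂ (UniversalEnvelopingAlgebra ℂ (T → Matrix (Fin k) (Fin k) ℂ))) :
    envActGL k d τ₀ z Δ =
      MvPolynomial.eval (fun p : T × Fin k => blockWt τ₀ χ p.1 p.2)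
        (Literature.NumberTheory.Automorphic.HCCore.hcProj T k z) • Δ := by
  classical
  set c : ℂ := MvPolynomial.eval (fun p : T × Fin k => blockWt τ₀ χ p.1 p.2)
    (Literature.NumberTheory.Automorphic.HCCore.hcProj T k z) with hc
  refine Submodule.span_induction (p := fun x _ => envActGL k d τ₀ z x = c • x) ?_ ?_ ?_ ?_
    (mem_span_translates_homogeneous_of_mem_hwSubrep hΔ hΔχ)
  · rintro _ ⟨g, v, hvδ, hvχ, rfl⟩
    -- `ρ(g)` on degree `δ` is an element `P` of the `lieOp`-algebra, which commutes with `z`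
    obtain ⟨P, hP, hPv⟩ := exists_adjoin_lieOp_eq_coordRep (d := d) g δ
    have hv : v.IsHomogeneous δ := (mem_homogeneousSubmodule δ v).1 hvδ
    rw [← hPv v hv, ← Module.End.mul_apply, ← envActGL_center_comm_of_mem_adjoin τ₀ hz hP,
      Module.End.mul_apply, envActGL_center_apply_of_mem_highestWeightSpace τ₀ hvχ hz, ← hc, map_smul]
  · rw [map_zero, smul_zero]
  · intro x y _ _ hx hy
    rw [map_add, hx, hy, smul_add]
  · intro a x _ hx
    rw [map_smul, hx, smul_comm]

/-- **The Casimir elements `C_p = Σ E_{i₁i₂} E_{i₂i₃} ⋯ E_{i_p i₁} = tr(𝔼^p)` of [BDGIL24, (8)]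
(the tree's `HCCore.casimir`, central by `HCCore.casimir_mem_center`) act on the `λ`-isotypic
component of `ℂ[ℂ[x₁,…,x_k]_d]_δ` by the scalars `χ_λ(C_p)`.** The printed closed form (9)
(Perelomov–Popov) for these scalars is NOT typed.
[cite: BergEtAl2024, §4.4 eq. (8)–(9), p.21 (PDF p.22)] locator: paper:arxiv-2411.03444 p0022.txt:L1–L9, L32–L35 -/
theorem envActGL_casimir_apply_of_mem_hwSubrep {δ : ℕ} {χ : Weight (Fin k)}
    {Δ : MvPolynomial (DegIdx (Fin k) d) ℂ} (hΔ : Δ.IsHomogeneous δ)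
    (hΔχ : Δ ∈ hwSubrep (coordRep (Fin k) ℂ d) χ) (p : ℕ) :
    envActGL k d τ₀ (Literature.NumberTheory.Automorphic.HCCore.casimir k τ₀ p) Δ =
      MvPolynomial.eval (fun q : T × Fin k => blockWt τ₀ χ q.1 q.2)
        (Literature.NumberTheory.Automorphic.HCCore.hcProj T k
          (Literature.NumberTheory.Automorphic.HCCore.casimir k τ₀ p)) • Δ :=
  envActGL_center_apply_of_mem_hwSubrep τ₀ hΔ hΔχ
    (Literature.NumberTheory.Automorphic.HCCore.casimir_mem_center τ₀ p)

/-! ### [BDGIL24, Cor. 5.5] with its LENGTH bound, in `U(gl_k)` -/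

section Length

-- the PBW order on the index type `Idx T k = T × Fin k × Fin k` of the standard basis `stdB`
-- (`𝔫⁻ < 𝔥 < 𝔫⁺`), registered locally exactly as in `HarishChandraCore` (the product type carries
-- the pointwise partial order globally; `Literature.Algebra.Lie.PBW.fil` takes the order as an instance)
attribute [local instance] Literature.NumberTheory.Automorphic.HCCore.idxLinearOrder

open Literature.Algebra.Lie.PBW (fil fil_mono mul_mem_fil ι_mem_fil_one word_mem_fil word_nil)
open Literature.NumberTheory.Automorphic.HCCore (stdB)

/-- `1 ∈ U(𝔤)_{≤0}`. [cite: BergEtAl2024, §4.3, p.19 (PDF p.20)] locator: paper:arxiv-2411.03444 p0020.txt:L17–L24 -/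
theorem one_mem_fil_zero :
    (1 : UniversalEnvelopingAlgebra ℂ (T → Matrix (Fin k) (Fin k) ℂ)) ∈ fil (stdB T k) 0 := by
  rw [← word_nil (stdB T k)]
  exact word_mem_fil (stdB T k) List.Pairwise.nil le_rfl

/-- An affine expression `c · (X − a · 1)` in a generator `X ∈ gl_k` has length `≤ 1`
(`U(𝔤)_{≤1} ⊇ ℂ ⊕ 𝔤`). [cite: BergEtAl2024, §4.3, p.19 (PDF p.20)] locator: paper:arxiv-2411.03444 p0020.txt:L17–L24 -/
theorem smul_ι_sub_algebraMap_mem_fil_one (c a : ℂ) (X : T → Matrix (Fin k) (Fin k) ℂ) :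
    c • (UniversalEnvelopingAlgebra.ι ℂ X -
        algebraMap ℂ (UniversalEnvelopingAlgebra ℂ (T → Matrix (Fin k) (Fin k) ℂ)) a) ∈
      fil (stdB T k) 1 := by
  refine Submodule.smul_mem _ c (Submodule.sub_mem _ (ι_mem_fil_one (stdB T k) X) ?_)
  rw [Algebra.algebraMap_eq_smul_one]
  exact Submodule.smul_mem _ a (fil_mono (stdB T k) (Nat.zero_le 1) one_mem_fil_zero)

/-- **The filtration is multiplicative along lists**: a product of `r` elements of length `≤ 1` has
length `≤ r` ("if `X ∈ U(𝔤)_{≤p}`, `Y ∈ U(𝔤)_{≤q}` then `XY ∈ U(𝔤)_{≤(p+q)}`").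
[cite: BergEtAl2024, §4.3, p.19 (PDF p.20)] locator: paper:arxiv-2411.03444 p0020.txt:L17–L21 -/
theorem list_prod_mem_fil_length {l : List (UniversalEnvelopingAlgebra ℂ (T → Matrix (Fin k) (Fin k) ℂ))}
    (hl : ∀ x ∈ l, x ∈ fil (stdB T k) 1) : l.prod ∈ fil (stdB T k) l.length := by
  induction l with
  | nil =>
    rw [List.prod_nil, List.length_nil]
    exact one_mem_fil_zero
  | cons x l ih =>
    rw [List.prod_cons, List.length_cons, add_comm]
    exact mul_mem_fil (stdB T k) (hl x (List.mem_cons.2 (Or.inl rfl)))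
      (ih fun y hy => hl y (List.mem_cons.2 (Or.inr hy)))

omit [Fintype T] in
/-- The generator `E_{ii}` of `U(gl_k)` acts as the Cartan operator `eulerOp i`.
[cite: BergEtAl2024, §5.1.1, p.27 (PDF p.28)] -/
theorem envActGL_ι_diagonal_single (i : Fin k) :
    envActGL k d τ₀ (UniversalEnvelopingAlgebra.ι ℂ (Pi.single τ₀ (Matrix.diagonal (Pi.single i (1 : ℂ))) : T → Matrix (Fin k) (Fin k) ℂ)) =
      (eulerOp k d i : Module.End ℂ (MvPolynomial (DegIdx (Fin k) d) ℂ)) := by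
  rw [envActGL_ι, Pi.single_eq_same, lieOp_single_eq_eulerOp]

/-- **[BDGIL24, Cor. 5.5] with its length bound, literally in `U(gl_k)`**: "For each weight `μ` […]
there is an element `H_μ ∈ U(gl_k)` of length at most `(δd)^k` which acts on `ℂ[ℂ[x₁,…,x_k]_d]_δ`
as the projector onto the weight space corresponding to `μ`." Typed: `H ∈ U(T → gl_k)` (block
model, block `τ₀`) of PBW-filtration level `≤ (δd + 1)^k` — the length of §4.3 ("the minimal `ℓ` such that
`X ∈ U(𝔤)_{≤ℓ}`", `U(𝔤)_{≤ℓ}` = the tree's `Literature.Algebra.Lie.PBW.fil`) — acting on every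
homogeneous `Δ` of degree `δ` as the weight-`μ` projection `weightedHomogeneousComponent`. `H` is
the ordered product of the `≤ (δd+1)^k` affine factors `c·E_{ii} − a` of the tree's `cor_5_5`
(Thm. 5.2 over the Cartan generators). Deviation (as in `cor_5_5`): the printed count `(dδ)^k` of
the weights of the box is replaced by the tree's honest `(δd + 1)^k` (`card_weightBox_le`).
[cite: BergEtAl2024, Cor. 5.5, p.27 (PDF p.28)] locator: paper:arxiv-2411.03444 p0028.txt:L24–L27 -/
theorem cor_5_5_length (k d δ : ℕ) (χ : Weight (Fin k)) :
    ∃ H : UniversalEnvelopingAlgebra ℂ (T → Matrix (Fin k) (Fin k) ℂ),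
      H ∈ fil (stdB T k) ((δ * d + 1) ^ k) ∧
        ∀ Δ : MvPolynomial (DegIdx (Fin k) d) ℂ, Δ.IsHomogeneous δ →
          envActGL k d τ₀ H Δ = weightedHomogeneousComponent
            (fun ν : DegIdx (Fin k) d => (fun i : Fin k => -((ν.1 i : ℕ) : ℤ))) χ Δ := by
  obtain ⟨L, hlen, hL⟩ := cor_5_5 k d δ χ
  -- the same ordered product of affine factors, now inside `U(gl_k)`
  let f : Fin k × ℂ × ℂ → UniversalEnvelopingAlgebra ℂ (T → Matrix (Fin k) (Fin k) ℂ) := fun t =>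
    t.2.1 • (UniversalEnvelopingAlgebra.ι ℂ (Pi.single τ₀ (Matrix.diagonal (Pi.single t.1 (1 : ℂ))) : T → Matrix (Fin k) (Fin k) ℂ) -
      algebraMap ℂ (UniversalEnvelopingAlgebra ℂ (T → Matrix (Fin k) (Fin k) ℂ)) t.2.2)
  refine ⟨(L.map f).prod, ?_, fun Δ hΔ => ?_⟩
  · have h := list_prod_mem_fil_length (k := k) (l := L.map f) fun x hx => by
      obtain ⟨t, -, rfl⟩ := List.mem_map.1 hx
      exact smul_ι_sub_algebraMap_mem_fil_one _ _ _
    rw [List.length_map] at h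
    exact fil_mono (stdB T k) hlen h
  · rw [← hL Δ hΔ, map_list_prod, List.map_map]
    congr 2
    refine List.map_congr_left fun t _ => ?_
    rw [Function.comp_apply, map_smul, map_sub, AlgHom.commutes, envActGL_ι_diagonal_single]

/-- **Cor. 5.5 (length form) as THE weight projector**: the element `H` of length `≤ (δd+1)^k`
satisfies `H.Δ ∈ V_μ` and `Δ − H.Δ ∈ ⨆_{μ'≠μ} V_{μ'}` for every homogeneous `Δ` of degree `δ`
(characterisation of `thm_1_1_weight`; unique by `weightComponent_unique`).
[cite: BergEtAl2024, Cor. 5.5, p.27 (PDF p.28)] locator: paper:arxiv-2411.03444 p0028.txt:L24–L27 -/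
theorem cor_5_5_length_weightSpace (k d δ : ℕ) (χ : Weight (Fin k)) :
    ∃ H : UniversalEnvelopingAlgebra ℂ (T → Matrix (Fin k) (Fin k) ℂ),
      H ∈ fil (stdB T k) ((δ * d + 1) ^ k) ∧
        ∀ Δ : MvPolynomial (DegIdx (Fin k) d) ℂ, Δ.IsHomogeneous δ →
          envActGL k d τ₀ H Δ ∈ weightSpace (coordRep (Fin k) ℂ d) χ ∧
            Δ - envActGL k d τ₀ H Δ ∈
              ⨆ χ' ∈ {χ' : Weight (Fin k) | χ' ≠ χ}, weightSpace (coordRep (Fin k) ℂ d) χ' := by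
  obtain ⟨H, hH, hHΔ⟩ := cor_5_5_length τ₀ k d δ χ
  refine ⟨H, hH, fun Δ hΔ => ?_⟩
  rw [hHΔ Δ hΔ]
  exact ⟨weightedHomogeneousComponent_mem_weightSpace χ Δ, sub_weightedHomogeneousComponent_mem χ Δ⟩

end Length

/-! ### The isotypic components are graded by the degree `δ`; the central character on all of `ℂ[ℂ[x]_d]` -/

section Graded

/-- `coordRep g` commutes with taking homogeneous components (it preserves every degree).
[cite: BergEtAl2024, §2.2, p.7 (PDF p.8)] locator: paper:arxiv-2411.03444 p0008.txt:L32–L38 -/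
theorem homogeneousComponent_coordRep (g : GL (Fin k) ℂ) (F : MvPolynomial (DegIdx (Fin k) d) ℂ)
    (n : ℕ) :
    homogeneousComponent n (coordRep (Fin k) ℂ d g F) =
      coordRep (Fin k) ℂ d g (homogeneousComponent n F) := by
  classical
  conv_lhs => rw [← sum_homogeneousComponent F, map_sum, map_sum]
  have hmem : ∀ i : ℕ, coordRep (Fin k) ℂ d g (homogeneousComponent i F) ∈
      homogeneousSubmodule (DegIdx (Fin k) d) ℂ i := fun i =>
    (mem_homogeneousSubmodule i _).2 (isHomogeneous_coordSubst g (homogeneousComponent_isHomogeneous i F))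
  rw [Finset.sum_eq_single n]
  · rw [homogeneousComponent_of_mem (hmem n), if_pos rfl]
  · intro i _ hi
    rw [homogeneousComponent_of_mem (hmem i), if_neg (Ne.symm hi)]
  · intro hn
    rw [Finset.mem_range, not_lt, Nat.succ_le_iff] at hn
    rw [homogeneousComponent_eq_zero _ _ hn, map_zero, map_zero]

/-- **Highest weight spaces of the metapolynomial representation are graded by degree**: the
homogeneous components of a highest weight vector of weight `χ` are highest weight vectors of
weight `χ`. [cite: BergEtAl2024, §2.2, p.7 (PDF p.8)] locator: paper:arxiv-2411.03444 p0008.txt:L32–L38 -/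
theorem homogeneousComponent_mem_highestWeightSpace {χ : Weight (Fin k)}
    {F : MvPolynomial (DegIdx (Fin k) d) ℂ} (hF : F ∈ highestWeightSpace (coordRep (Fin k) ℂ d) χ)
    (n : ℕ) : homogeneousComponent n F ∈ highestWeightSpace (coordRep (Fin k) ℂ d) χ := by
  rw [mem_highestWeightSpace_iff] at hF ⊢
  intro g hg
  rw [← homogeneousComponent_coordRep, hF g hg, map_smul]

/-- **Isotypic components of the metapolynomial representation are graded by degree**: the
homogeneous components of an element of `hwSubrep (coordRep) χ` lie in `hwSubrep (coordRep) χ`.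
[cite: BergEtAl2024, §2.2, p.7 (PDF p.8)] locator: paper:arxiv-2411.03444 p0008.txt:L32–L38 -/
theorem homogeneousComponent_mem_hwSubrep {χ : Weight (Fin k)}
    {Δ : MvPolynomial (DegIdx (Fin k) d) ℂ} (hΔ : Δ ∈ hwSubrep (coordRep (Fin k) ℂ d) χ) (n : ℕ) :
    homogeneousComponent n Δ ∈ hwSubrep (coordRep (Fin k) ℂ d) χ := by
  unfold hwSubrep at hΔ ⊢
  induction hΔ using Submodule.span_induction with
  | mem w hw =>
    obtain ⟨g, v, hv, rfl⟩ := hw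
    rw [homogeneousComponent_coordRep]
    exact Submodule.subset_span ⟨g, _, homogeneousComponent_mem_highestWeightSpace hv n, rfl⟩
  | zero =>
    rw [map_zero]
    exact Submodule.zero_mem _
  | add x y _ _ hx hy =>
    rw [map_add]
    exact Submodule.add_mem _ hx hy
  | smul a x _ hx =>
    rw [map_smul]
    exact Submodule.smul_mem _ a hx

/-- **[BDGIL24, §4.4] on the whole space of metapolynomials**: `Z(gl_k)` acts on the `λ`-isotypic
component of `ℂ[ℂ[x₁,…,x_k]_d]` (all degrees) by the central character `χ_λ` — degree by degree
from `envActGL_center_apply_of_mem_hwSubrep`, the isotypic components being graded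
(`homogeneousComponent_mem_hwSubrep`).
[cite: BergEtAl2024, §4.4, p.20 (PDF p.21)] locator: paper:arxiv-2411.03444 p0021.txt:L18–L27 -/
theorem envActGL_center_apply_of_mem_hwSubrep' {χ : Weight (Fin k)}
    {Δ : MvPolynomial (DegIdx (Fin k) d) ℂ} (hΔχ : Δ ∈ hwSubrep (coordRep (Fin k) ℂ d) χ)
    {z : UniversalEnvelopingAlgebra ℂ (T → Matrix (Fin k) (Fin k) ℂ)}
    (hz : z ∈ Subalgebra.center ℂ (UniversalEnvelopingAlgebra ℂ (T → Matrix (Fin k) (Fin k) ℂ))) :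
    envActGL k d τ₀ z Δ =
      MvPolynomial.eval (fun p : T × Fin k => blockWt τ₀ χ p.1 p.2)
        (Literature.NumberTheory.Automorphic.HCCore.hcProj T k z) • Δ := by
  conv_lhs => rw [← sum_homogeneousComponent Δ, map_sum]
  rw [Finset.sum_congr rfl fun n _ => envActGL_center_apply_of_mem_hwSubrep τ₀
    (homogeneousComponent_isHomogeneous n Δ) (homogeneousComponent_mem_hwSubrep hΔχ n) hz,
    ← Finset.smul_sum, sum_homogeneousComponent]

end Graded

end BergEtAl2024

end Literature.Barriers.ValiantsHypothesis
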